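import Summits.Ventures.PercRepro.RLSRuleT1Tools
import Summits.Ventures.PercRepro.RLSRuleOneLine

/-!
# C-025 at q = 3: the `5`-point plane «`3`-point line + two points» at `t ≥ 1` — geometry and counting (night-3, gen 4)

The pieces of the `t = 1` / `t = 2` accountings of the plane `G = ℓ ∪ {a, b}` (`OneLine M G ℓ` with `|G| = 5`, the
fifth of the six `𝒯₀` planes) that depend on its shape:

* `exists_indep_triple_of_rho3_pos`, `eRk_eq_three_of_four_oneLine` (every `4`-subset has rank `3`: `ρ₃ ≥ 3`);
* `oneLineFive_family` — the `9` independent triples, the `5` four-subsets and `G`: ranks, disjointness, cards;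
* `sum_powersetCard_four_oneLine` — a sum over the five `4`-subsets: two through `ℓ`, three through no line;
* `UqG_subset_of_oneLineFive_t1` / `_t2` — the bottom sets at `t = 1` are among the triples and the `4`-subsets
  (`≤ 14`), at `t = 2` among the triples (`≤ 9`);
* `sum_good_five_t1` — the plane on its good witnesses pays `9(t1z2 − lost5)` at `t = 1`.
Imports `RLSRuleT1Tools`, `RLSRuleOneLine`.  Axioms: standard.
-/

open scoped Matroid

namespace PercRepro

namespace NightThree

open Finset ThmH PerFlat

variable {α : Type*} [DecidableEq α] {M : Matroid α} [M.Finite]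

omit [DecidableEq α] [M.Finite] in
/-- A set with `ρ₃ > 0` contains an independent triple. -/
theorem exists_indep_triple_of_rho3_pos {B : Finset α} (h : 0 < rho3 M B) :
    ∃ T ⊆ B, T.card = 3 ∧ M.Indep (T : Set α) := by
  classical
  unfold rho3 at h
  obtain ⟨T, hT⟩ := Finset.card_pos.1 h
  rw [Finset.mem_filter, Finset.mem_powersetCard] at hT
  exact ⟨T, hT.1.1, hT.1.2, hT.2⟩

/-- Every `4`-subset of a `OneLine` plane has rank `3`. -/
theorem eRk_eq_three_of_four_oneLine {G ℓ B : Finset α} (hG : G ∈ flatsQ M 3) (h : OneLine M G ℓ) (hB : B ⊆ G)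
    (hBc : B.card = 4) : M.eRk (B : Set α) = 3 := by
  have hG3 : M.eRk (G : Set α) = 3 := eRk_eq_three_of_mem_flatsQ' hG
  apply le_antisymm
  · rw [← hG3]; exact M.eRk_mono (Finset.coe_subset.2 hB)
  · have hpos : 0 < rho3 M B := by
      rw [rho3_of_oneLine h hB, hBc]
      split_ifs <;> norm_num [Nat.choose]
    obtain ⟨T, hTB, hTc, hTind⟩ := exists_indep_triple_of_rho3_pos hpos
    rw [← eRk_eq_three_of_indep_card hTind hTc]
    exact M.eRk_mono (Finset.coe_subset.2 hTB)

/-- The `9` independent triples, the `5` four-subsets and `G` itself of the plane `ℓ ∪ {a, b}`: every member has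
rank `3`; the pieces are disjoint; cards `9` and `5`. -/
theorem oneLineFive_family {G ℓ : Finset α} (hG : G ∈ flatsQ M 3) (h : OneLine M G ℓ) (hGc : G.card = 5) :
    (∀ B ∈ (G.powersetCard 3).erase ℓ, B ⊆ G ∧ B.card = 3 ∧ ¬ ℓ ⊆ B ∧ M.Indep (B : Set α)) ∧
    (∀ B ∈ (G.powersetCard 3).erase ℓ ∪ G.powersetCard 4 ∪ {G}, B ⊆ G ∧ M.eRk (B : Set α) = 3) ∧
    Disjoint ((G.powersetCard 3).erase ℓ) (G.powersetCard 4) ∧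
    Disjoint ((G.powersetCard 3).erase ℓ ∪ G.powersetCard 4) {G} ∧
    ((G.powersetCard 3).erase ℓ).card = 9 ∧ (G.powersetCard 4).card = 5 := by
  classical
  obtain ⟨hℓG, hℓc, hℓr, hone⟩ := h
  have h' : OneLine M G ℓ := ⟨hℓG, hℓc, hℓr, hone⟩
  have hG3 : M.eRk (G : Set α) = 3 := eRk_eq_three_of_mem_flatsQ' hG
  have hmem3 : ∀ B ∈ (G.powersetCard 3).erase ℓ, B ⊆ G ∧ B.card = 3 ∧ ¬ ℓ ⊆ B ∧ M.Indep (B : Set α) := by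
    intro B hB
    rw [Finset.mem_erase, Finset.mem_powersetCard] at hB
    obtain ⟨hBℓ, hBG, hBc⟩ := hB
    refine ⟨hBG, hBc, ?_, hone B (Finset.mem_powersetCard.2 ⟨hBG, hBc⟩) hBℓ⟩
    intro hl; exact hBℓ (Finset.eq_of_subset_of_card_le hl (by omega)).symm
  refine ⟨hmem3, ?_, ?_, ?_, ?_, ?_⟩
  · intro B hB
    rw [Finset.mem_union, Finset.mem_union, Finset.mem_singleton] at hB
    rcases hB with (hB | hB) | hBG'
    · obtain ⟨hBG, hBc, _, hBind⟩ := hmem3 B hB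
      exact ⟨hBG, eRk_eq_three_of_indep_card hBind hBc⟩
    · obtain ⟨hBG, hBc⟩ := Finset.mem_powersetCard.1 hB
      exact ⟨hBG, eRk_eq_three_of_four_oneLine hG h' hBG hBc⟩
    · rw [hBG']; exact ⟨le_rfl, hG3⟩
  · rw [Finset.disjoint_left]
    intro B h3 h4
    have := (hmem3 B h3).2.1
    have := (Finset.mem_powersetCard.1 h4).2
    omega
  · rw [Finset.disjoint_right]
    intro B hB
    rw [Finset.mem_singleton] at hB
    rw [hB, Finset.mem_union]
    rintro (h3 | h4)
    · have := (hmem3 G h3).2.1; omega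
    · have := (Finset.mem_powersetCard.1 h4).2; omega
  · rw [Finset.card_erase_of_mem (Finset.mem_powersetCard.2 ⟨hℓG, hℓc⟩), Finset.card_powersetCard, hGc]
    rfl
  · rw [Finset.card_powersetCard, hGc]; rfl

omit [M.Finite] in
/-- Summing over the five `4`-subsets of the plane `ℓ ∪ {a, b}`: two through `ℓ`, three through no line. -/
theorem sum_powersetCard_four_oneLine {G ℓ : Finset α} (hℓG : ℓ ⊆ G) (hℓc : ℓ.card = 3) (hGc : G.card = 5)
    (g : Finset α → ℚ) {vL vg : ℚ}
    (hL : ∀ B ∈ G.powersetCard 4, ℓ ⊆ B → g B = vL) (hg : ∀ B ∈ G.powersetCard 4, ¬ ℓ ⊆ B → g B = vg) :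
    ∑ B ∈ G.powersetCard 4, g B = 2 * vL + 3 * vg := by
  classical
  set P := G.powersetCard 4 with hP
  have hPc : P.card = 5 := by rw [hP, Finset.card_powersetCard, hGc]; rfl
  have hcL : (P.filter (fun B => ℓ ⊆ B)).card = 2 := card_filter_four_line hℓG hℓc hGc
  have hcg : (P.filter (fun B => ¬ ℓ ⊆ B)).card = 3 := by
    have h1 := Finset.card_filter_add_card_filter_not (s := P) (fun B => ℓ ⊆ B)
    rw [hcL, hPc] at h1
    omega
  rw [← Finset.sum_filter_add_sum_filter_not P (fun B => ℓ ⊆ B),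
    Finset.sum_congr rfl (fun B hB => hL B (Finset.mem_filter.1 hB).1 (Finset.mem_filter.1 hB).2),
    Finset.sum_congr rfl (fun B hB => hg B (Finset.mem_filter.1 hB).1 (Finset.mem_filter.1 hB).2),
    Finset.sum_const, Finset.sum_const, hcL, hcg]
  simp only [nsmul_eq_mul]
  push_cast
  ring

/-- At `t = 1` the bottom sets of the plane `ℓ ∪ {a, b}` are among the `9` triples and the `5` four-subsets. -/
theorem UqG_subset_of_oneLineFive_t1 {G ℓ : Finset α} {n : ℕ} (h : OneLine M G ℓ) (hGc : G.card = 5)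
    (hK : M.eRk ((gr M \ G : Finset α) : Set α) = ((n + 3 : ℕ) : ℕ∞)) :
    UqG M (n + 4) 3 G ⊆ (G.powersetCard 3).erase ℓ ∪ G.powersetCard 4 := by
  obtain ⟨hℓG, hℓc, hℓr, hone⟩ := h
  intro B hB
  have hle := card_add_le_of_mem_UqG hB hK (by omega : n + 3 + 1 ≤ n + 4)
  have hB' := hB
  unfold UqG at hB'
  rw [Finset.mem_filter, mem_Uq] at hB'
  obtain ⟨⟨_, hB3, _⟩, hBG⟩ := hB'
  have hB3' : M.eRk (B : Set α) = 3 := by exact_mod_cast hB3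
  have hBc := three_le_card_of_eRk_eq_three hB3'
  rw [Finset.mem_union]
  rcases Nat.lt_or_ge B.card 4 with h3 | h4
  · left
    rw [Finset.mem_erase, Finset.mem_powersetCard]
    refine ⟨?_, hBG, by omega⟩
    rintro rfl; rw [hℓr] at hB3'; exact absurd hB3' (by decide)
  · right
    rw [Finset.mem_powersetCard]; exact ⟨hBG, by omega⟩

/-- At `t = 2` the bottom sets of the plane `ℓ ∪ {a, b}` are among the `9` independent triples. -/
theorem UqG_subset_of_oneLineFive_t2 {G ℓ : Finset α} {n : ℕ} (h : OneLine M G ℓ) (hGc : G.card = 5)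
    (hK : M.eRk ((gr M \ G : Finset α) : Set α) = ((n + 2 : ℕ) : ℕ∞)) :
    UqG M (n + 4) 3 G ⊆ (G.powersetCard 3).erase ℓ := by
  obtain ⟨hℓG, hℓc, hℓr, hone⟩ := h
  intro B hB
  have hle := card_add_le_of_mem_UqG hB hK (by omega : n + 2 + 2 ≤ n + 4)
  have hB' := hB
  unfold UqG at hB'
  rw [Finset.mem_filter, mem_Uq] at hB'
  obtain ⟨⟨_, hB3, _⟩, hBG⟩ := hB'
  have hB3' : M.eRk (B : Set α) = 3 := by exact_mod_cast hB3
  have hBc := three_le_card_of_eRk_eq_three hB3'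
  rw [Finset.mem_erase, Finset.mem_powersetCard]
  refine ⟨?_, hBG, by omega⟩
  rintro rfl; rw [hℓr] at hB3'; exact absurd hB3' (by decide)

omit [M.Finite] in
/-- The good witnesses of the `5`-set `ℓ ∪ {a, b}` (`ρ₃ = 9`) pay `9(t1z2 − lost5)` at `t = 1`. -/
theorem sum_good_five_t1 {K C : Finset α} {n : ℕ} (hn : 2 ≤ n) (hK : K.card = n + 3) (hC : C ⊆ K)
    (hCc : C.card = 3) :
    ∑ X ∈ (witnessFamily K n).filter (fun X => ¬ C ⊆ X), 9 / (((5 + X.card).choose 3 : ℕ) : ℚ) =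
      9 * W1.t1z2Sum n - 9 * W1.t1lost5Sum n := by
  classical
  have hfull : ∑ X ∈ witnessFamily K n, 9 / (((5 + X.card).choose 3 : ℕ) : ℚ) = 9 * W1.t1z2Sum n := by
    rw [sum_witnessFamily K n (fun x => 9 / (((5 + x).choose 3 : ℕ) : ℚ)), hK]
    unfold W1.t1z2Sum
    rw [Finset.mul_sum]
    apply Finset.sum_congr rfl
    intro i _
    rw [show 5 + (i + 1) = i + 6 by omega]
    ring
  have hlost : ∑ X ∈ (witnessFamily K n).filter (fun X => C ⊆ X), 9 / (((5 + X.card).choose 3 : ℕ) : ℚ) =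
      9 * W1.t1lost5Sum n := by
    rw [sum_filter_subset_witnessFamily_t1 hn hK hC hCc (fun x => 9 / (((5 + x).choose 3 : ℕ) : ℚ))]
    unfold W1.t1lost5Sum
    rw [Finset.mul_sum]
    apply Finset.sum_congr rfl
    intro j _
    rw [show 5 + (j + 3) = j + 8 by omega]
    ring
  have hsplit := Finset.sum_filter_add_sum_filter_not (witnessFamily K n) (fun X => C ⊆ X)
    (fun X => 9 / (((5 + X.card).choose 3 : ℕ) : ℚ))
  linarith

end NightThree

end PercRepro
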